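import Mathlib

/-!
# Sketch — crux idea `polchinski-flow-skewness` (crux stmt-QuantumFields-16205, `LangevinControlUV.FemtoCurvatureSkewnessC`)

First lemmas of the line, stated over Mathlib only (they need not be proved here; they must elaborate).

* `heat1d L t m`      : the heat kernel of the continuous-time simple random walk on `ℤ/L`,
                        `q_t(m) = L⁻¹ Σ_k exp(-t k̂²) cos(2πkm/L)`, `k̂² = 2 - 2cos(2πk/L)`.
* `sliceKernelPerp`   : the Polchinski (heat-kernel) SLICE at flow time `t` of the transverse `F₀₁–F₀₁` lattice kernel
                        at a displacement `z = (0,0,z₂,z₃)` PERPENDICULAR to the plaquette plane, in product form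
                        `K_t(z) = 4 (q_t(0) - q_t(1)) q_t(0) q_t(z₂) q_t(z₃)`.
* `sliceKernelMomentum`: the same slice in momentum form `L⁻⁴ Σ_k (k̂₀²+k̂₁²) e^{-t k̂²} cos(2π(k₂z₂+k₃z₃)/L)`.
* `SliceProductFormula` (L1): momentum form = product form (separation of variables of the torus heat kernel).
* `HeatSlicePerpPos` (L2, the idea's First lemma): EVERY slice is strictly positive at EVERY perpendicular
  displacement, every `t > 0`, every `L ≥ 2` — because the 1-d torus heat kernel is positive and maximal at `0`.
* `SliceIntegral` (L3): `∫₀^∞ K_t(z) dt = L⁻⁴ · G_L(z)`, the zero-mode-free transverse torus propagator of the landed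
  `PerpPropagatorPos` / `TreeRatioFloor` (the `k = 0` term carries the weight `k̂₀²+k̂₁² = 0`, so no zero-mode
  subtraction is needed slice by slice).  Hence `PerpPropagatorPos` is the `t`-integral of a positive function.
* `flowTriangleTelescope` (L4): the exact DISCRETE flow decomposition of a Gaussian triangle `tr(M₁ C M₂ C M₃ C)` along
  any finite covariance decomposition `C = Σ_{j<J} Ċ_j` (telescoping of a trilinear form): one slice in one leg, tails
  `D_j = Σ_{i ≥ j} Ċ_i` / `D_{j+1}` in the other two.  With (L2) every term of the decomposed tree-level skewness of the
  crux's triple `(0, n e₂, n e₃)` is `≥ 0`: the tree triangle is positive SCALE BY SCALE, not by cancellation.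

The interacting statement of the line (exact Polchinski-flow cumulant identity for Wilson's femto measure in the
axial `A`-chart, and coalescence-window dominance) is described in the idea card; it is typed at crux-plan time.
-/

noncomputable section

namespace Summit.QuantumFields.YangMills.Cruxes.FemtoCurvatureSkewnessC.PolchinskiFlow

open Finset MeasureTheory
open scoped BigOperators

/-- Lattice "momentum squared" of the mode `k ∈ ℤ/L`: `k̂² = 2 - 2cos(2πk/L)`. -/
def khat2 (L : ℕ) [NeZero L] (k : ZMod L) : ℝ :=
  2 - 2 * Real.cos (2 * Real.pi * (k.val : ℝ) / L)

/-- Heat kernel of the continuous-time simple random walk on the discrete circle `ℤ/L` at time `t`, evaluated at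
`m ∈ ℤ` (it is `L`-periodic in `m`): `q_t(m) = L⁻¹ Σ_k exp(-t k̂²) cos(2π k m / L)`. -/
def heat1d (L : ℕ) [NeZero L] (t : ℝ) (m : ℤ) : ℝ :=
  (1 / (L : ℝ)) * ∑ k : ZMod L, Real.exp (-t * khat2 L k) * Real.cos (2 * Real.pi * (k.val : ℝ) * (m : ℝ) / L)

/-- The Polchinski/heat-kernel slice at flow time `t` of the transverse `F₀₁–F₀₁` kernel of the lattice Maxwell field on
`(ℤ/L)⁴` at the perpendicular displacement `(0,0,z₂,z₃)`, PRODUCT FORM: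
`K_t(z) = -(Δ₀+Δ₁) p_t(z) = 4 (q_t(0) - q_t(1)) · q_t(0) · q_t(z₂) · q_t(z₃)`. -/
def sliceKernelPerp (L : ℕ) [NeZero L] (t : ℝ) (z₂ z₃ : ℤ) : ℝ :=
  4 * (heat1d L t 0 - heat1d L t 1) * heat1d L t 0 * heat1d L t z₂ * heat1d L t z₃

/-- The same slice, MOMENTUM FORM: `L⁻⁴ Σ_{k ∈ (ℤ/L)⁴} (k̂₀² + k̂₁²) exp(-t Σᵢ k̂ᵢ²) cos(2π(k₂ z₂ + k₃ z₃)/L)`.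
(The `k = 0` mode has weight `k̂₀²+k̂₁² = 0`: no zero-mode subtraction is needed.) -/
def sliceKernelMomentum (L : ℕ) [NeZero L] (t : ℝ) (z₂ z₃ : ℤ) : ℝ :=
  (1 / (L : ℝ) ^ 4) * ∑ k : Fin 4 → ZMod L,
    (khat2 L (k 0) + khat2 L (k 1)) * Real.exp (-t * (khat2 L (k 0) + khat2 L (k 1) + khat2 L (k 2) + khat2 L (k 3))) *
      Real.cos (2 * Real.pi * (((k 2).val : ℝ) * (z₂ : ℝ) + ((k 3).val : ℝ) * (z₃ : ℝ)) / L)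

/-- The zero-mode-free transverse torus propagator of the `(0,1)`-plaquette field at the perpendicular displacement
`(0,0,z₂,z₃)` — the un-normalised sum of the landed `PerpPropagatorPos` / `TreeRatioFloor` (there evaluated at `n e₂`
and `n(e₃ - e₂)`), written for a general perpendicular displacement. -/
def perpPropagatorSum (L : ℕ) [NeZero L] (z₂ z₃ : ℤ) : ℝ :=
  ∑ k : Fin 4 → ZMod L,
    (if k = 0 then 0 else (khat2 L (k 0) + khat2 L (k 1)) /
        (khat2 L (k 0) + khat2 L (k 1) + khat2 L (k 2) + khat2 L (k 3))) *
      Real.cos (2 * Real.pi * (((k 2).val : ℝ) * (z₂ : ℝ) + ((k 3).val : ℝ) * (z₃ : ℝ)) / L)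

/-- **L1 (separation of variables).** The momentum form of the slice equals the product form. -/
def SliceProductFormula : Prop :=
  ∀ (L : ℕ) [NeZero L], 2 ≤ L → ∀ (t : ℝ) (z₂ z₃ : ℤ), sliceKernelMomentum L t z₂ z₃ = sliceKernelPerp L t z₂ z₃

/-- **L2 — FIRST LEMMA of the idea (heat-slice perpendicular positivity).** Every Polchinski slice of the transverse
curvature kernel is strictly positive at every perpendicular displacement: `q_t > 0` on `ℤ/L` and `q_t(0) > q_t(1)`
for `t > 0`, `L ≥ 2`. -/
def HeatSlicePerpPos : Prop :=
  ∀ (L : ℕ) [NeZero L], 2 ≤ L → ∀ (t : ℝ), 0 < t → ∀ (z₂ z₃ : ℤ), 0 < sliceKernelPerp L t z₂ z₃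

/-- The two elementary facts behind L2, isolated. -/
def Heat1dPosAndPeaked : Prop :=
  ∀ (L : ℕ) [NeZero L], 2 ≤ L → ∀ (t : ℝ), 0 < t → (∀ m : ℤ, 0 < heat1d L t m) ∧ heat1d L t 1 < heat1d L t 0

/-- **L3 (slice integral = tree propagator).** `∫₀^∞ K_t(z) dt = L⁻⁴ G_L(z)`: the landed transverse propagator is the
flow integral of the positive slices (so `PerpPropagatorPos` is positivity of an integral of a positive function). -/
def SliceIntegral : Prop :=
  ∀ (L : ℕ) [NeZero L], 2 ≤ L → ∀ (z₂ z₃ : ℤ),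
    ∫ t in Set.Ioi (0 : ℝ), sliceKernelMomentum L t z₂ z₃ = (1 / (L : ℝ) ^ 4) * perpPropagatorSum L z₂ z₃

/-- **L4 (discrete flow decomposition of a Gaussian triangle; pure algebra).**  For square matrices `M₁ M₂ M₃` and a
finite covariance decomposition `Ċ : ℕ → Matrix`, with tails `D j = Σ_{j ≤ i < J} Ċ i` (so `D 0 = C`, `D J = 0`),
`tr(M₁ C M₂ C M₃ C) = Σ_{j<J} [tr(M₁ Ċⱼ M₂ Dⱼ M₃ Dⱼ) + tr(M₁ D_{j+1} M₂ Ċⱼ M₃ Dⱼ) + tr(M₁ D_{j+1} M₂ D_{j+1} M₃ Ċⱼ)]`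
— telescoping of the trilinear form `(A,B,C) ↦ tr(M₁ A M₂ B M₃ C)`. -/
theorem flowTriangleTelescope {m : ℕ} (M₁ M₂ M₃ : Matrix (Fin m) (Fin m) ℝ) (Cdot : ℕ → Matrix (Fin m) (Fin m) ℝ)
    (J : ℕ) :
    let D : ℕ → Matrix (Fin m) (Fin m) ℝ := fun j => ∑ i ∈ Finset.Ico j J, Cdot i
    Matrix.trace (M₁ * D 0 * M₂ * D 0 * M₃ * D 0) =
      ∑ j ∈ Finset.range J,
        (Matrix.trace (M₁ * Cdot j * M₂ * D j * M₃ * D j) +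
          Matrix.trace (M₁ * D (j + 1) * M₂ * Cdot j * M₃ * D j) +
          Matrix.trace (M₁ * D (j + 1) * M₂ * D (j + 1) * M₃ * Cdot j)) := by
  intro D
  -- telescoping: T(D j) - T(D (j+1)) = the three slice terms, and D J = 0
  have hstep : ∀ j, j < J → D j = Cdot j + D (j + 1) := by
    intro j hj
    show ∑ i ∈ Finset.Ico j J, Cdot i = Cdot j + ∑ i ∈ Finset.Ico (j + 1) J, Cdot i
    rw [Finset.sum_eq_sum_Ico_succ_bot hj]
  have hJ : D J = 0 := by
    show ∑ i ∈ Finset.Ico J J, Cdot i = 0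
    simp
  -- T as a function of j
  set T : ℕ → ℝ := fun j => Matrix.trace (M₁ * D j * M₂ * D j * M₃ * D j) with hT
  have hdiff : ∀ j ∈ Finset.range J,
      (Matrix.trace (M₁ * Cdot j * M₂ * D j * M₃ * D j) +
          Matrix.trace (M₁ * D (j + 1) * M₂ * Cdot j * M₃ * D j) +
          Matrix.trace (M₁ * D (j + 1) * M₂ * D (j + 1) * M₃ * Cdot j)) = T j - T (j + 1) := by
    intro j hj
    have hj' : j < J := Finset.mem_range.mp hj
    simp only [hT]
    rw [hstep j hj']
    simp only [Matrix.mul_add, Matrix.add_mul, Matrix.trace_add]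
    ring
  rw [Finset.sum_congr rfl hdiff, Finset.sum_range_sub']
  simp [hT, hJ]

/-! ## Readback of the target (nothing new): the crux decl this idea serves. -/

/-- The idea feeds the registered engine stub of line `coupling-cubic-response` through the landed reduction
`skewC_of_markedCouplingDominance` (refuter evidence `Attack.lean`, stmt-QuantumFields-16205): its output is one-loop
dominance of `n¹²κ₃` and `n⁸Cov_axis` with a COMMON positive factor on the femto tori of the hypothesis' continuous
unit map — here recorded only as the shape of the statement the flow method is to deliver (informal; typed at
crux-plan time over `wilsonExpectation`). -/
def FlowWindowDominanceShape : Prop :=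
  ∃ θ : ℝ, θ < 1 ∧ 0 ≤ θ ∧ HeatSlicePerpPos ∧ SliceProductFormula ∧ SliceIntegral

end Summit.QuantumFields.YangMills.Cruxes.FemtoCurvatureSkewnessC.PolchinskiFlow

end
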